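import Mathlib
import Summits.Ventures.PercRepro.PuncturedLYMUnif46Table
import Summits.Ventures.PercRepro.PuncturedLYMUnif46Rows1
import Summits.Ventures.PercRepro.PuncturedLYMUnif46Rows2
import Summits.Ventures.PercRepro.PuncturedLYMUnif46Rows3

/-!
# PercRepro — (SP) FOR ANY NUMBER OF PAIRWISE DISJOINT `4`-SETS AT LEVEL `6`: THE ROW IDENTITIES, ASSEMBLED
(p10, gen 40)

`row_check`: the row identity of every class with `Σ v c_v ≤ 6`, by `interval_cases` over the class counts.  Nothing here asserts (SP).
-/

namespace PercRepro.PuncturedLYM.Split.TypeLift.Unif46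

/-- The row identity of every class, in one statement. -/
theorem row_check (n k : ℚ) (hQ : Qp n k ≠ 0) (hP : Pp n k ≠ 0) (hPc : Pc n k ≠ 0) (c1 c2 c3 : ℕ)
    (h : c1 + 2 * c2 + 3 * c3 ≤ 6) :
    4 * (k - ((c1 : ℚ) + c2 + c3)) * raw n k c1 c2 c3 0 + 3 * (c1 : ℚ) * raw n k c1 c2 c3 1 + 2 * (c2 : ℚ) * raw n k c1 c2 c3 2 + (c3 : ℚ) / 4 +
      (n - 4 * k - ((6 : ℚ) - c1 - 2 * c2 - 3 * c3)) * raw n k c1 c2 c3 4 = Yc n / Pc n k := by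
  have hb1 : c1 ≤ 6 := by omega
  have hb2 : c2 ≤ 3 := by omega
  have hb3 : c3 ≤ 2 := by omega
  interval_cases c1 <;> interval_cases c2 <;> interval_cases c3 <;> push_cast
  · linear_combination row_000 n k hQ hP hPc
  · linear_combination row_001 n k hQ hP hPc
  · linear_combination row_002 n k hQ hP hPc
  · linear_combination row_010 n k hQ hP hPc
  · linear_combination row_011 n k hQ hP hPc
  · omega
  · linear_combination row_020 n k hQ hP hPc
  · omega
  · omega
  · linear_combination row_030 n k hQ hP hPc
  · omega
  · omega
  · linear_combination row_100 n k hQ hP hPc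
  · linear_combination row_101 n k hQ hP hPc
  · omega
  · linear_combination row_110 n k hQ hP hPc
  · linear_combination row_111 n k hQ hP hPc
  · omega
  · linear_combination row_120 n k hQ hP hPc
  · omega
  · omega
  · omega
  · omega
  · omega
  · linear_combination row_200 n k hQ hP hPc
  · linear_combination row_201 n k hQ hP hPc
  · omega
  · linear_combination row_210 n k hQ hP hPc
  · omega
  · omega
  · linear_combination row_220 n k hQ hP hPc
  · omega
  · omega
  · omega
  · omega
  · omega
  · linear_combination row_300 n k hQ hP hPc
  · linear_combination row_301 n k hQ hP hPc
  · omega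
  · linear_combination row_310 n k hQ hP hPc
  · omega
  · omega
  · omega
  · omega
  · omega
  · omega
  · omega
  · omega
  · linear_combination row_400 n k hQ hP hPc
  · omega
  · omega
  · linear_combination row_410 n k hQ hP hPc
  · omega
  · omega
  · omega
  · omega
  · omega
  · omega
  · omega
  · omega
  · linear_combination row_500 n k hQ hP hPc
  · omega
  · omega
  · omega
  · omega
  · omega
  · omega
  · omega
  · omega
  · omega
  · omega
  · omega
  · linear_combination row_600 n k hQ hP hPc
  · omega
  · omega
  · omega
  · omega
  · omega
  · omega
  · omega
  · omega
  · omega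
  · omega
  · omega

end PercRepro.PuncturedLYM.Split.TypeLift.Unif46
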